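import Literature.NumberTheory.LFunctions.LiouvilleSumClassicalBound
import HarnessLib

/-!
# Route `ChenParityOracleBLAP` — crux S1 = `HostParityFromBrick` (stmt-Parity-20045): Type-I sums, large moduli — piece bookkeeping

Support file for the prime half `K1 → K2 → HP1` of S1 (unconditional Type-I input).  Elementary
bookkeeping for cutting the large moduli `d ∈ (D₁, D]` into pieces `(D₁ + iL, D₁ + (i+1)L]`:
* `sum_div_arith_prog_le` — `∑_{i<I} L/(a + iL) ≤ 1 + log(a + IL)` for `1 ≤ L ≤ a`;
* `height_window` — for `d` in a piece `(D', D'+L]` and `r ≤ R` the switched height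
  `V(d,r) = ⌊(r⌊u/r⌋+2)/d⌋` lies in `[V₀, V₀ + H]` with `V₀ = ⌊(u+3−R)/(D'+L)⌋`,
  `V₀ + H = max(V₀, ⌊(u+2)/(D'+1)⌋)`;
* `height_window_H_le` — `H ≤ (x+2)L/(D'+1)² + R/(D'+1) + 1`.

References: H. Iwaniec, E. Kowalski, *Analytic Number Theory* (2004), §17.3 [IwaniecKowalski2004].
-/

namespace Summit.Parity.GeneralizedHardyLittlewood.Theorems

open Finset Real
open ArithmeticFunction (liouville)

/-- `∑_{i<I} L/(a + iL) ≤ ∑_{n ∈ (a-L, a-L+IL]} 1/n` for `1 ≤ L ≤ a` (each block of `L` consecutive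
integers ending at `a + iL` has reciprocals `≥ 1/(a+iL)`). -/
theorem sum_div_arith_prog_le_harmonic {a L : ℕ} (hLa : L ≤ a) (I : ℕ) :
    ∑ i ∈ range I, (L : ℝ) / (a + i * L) ≤ ∑ n ∈ Ioc (a - L) (a - L + I * L), (1 : ℝ) / n := by
  induction I with
  | zero => simp
  | succ I ih =>
    rw [Finset.sum_range_succ, ← Finset.sum_Ioc_consecutive _ (show a - L ≤ a - L + I * L by omega)
      (show a - L + I * L ≤ a - L + (I + 1) * L by nlinarith)]
    gcongr
    -- the block `(a - L + IL, a - L + (I+1)L] = (a + IL - L, a + IL]`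
    have hcard : #(Ioc (a - L + I * L) (a - L + (I + 1) * L)) = L := by
      rw [Nat.card_Ioc]; rw [add_mul, one_mul]; omega
    have hle : ∀ n ∈ Ioc (a - L + I * L) (a - L + (I + 1) * L), (1 : ℝ) / (a + I * L) ≤ 1 / n := by
      intro n hn
      rw [Finset.mem_Ioc] at hn
      have hn1 : (n : ℝ) ≤ a + I * L := by
        have : n ≤ a + I * L := by rw [add_mul, one_mul] at hn; omega
        exact_mod_cast this
      have hn0 : (0 : ℝ) < n := by exact_mod_cast (show 0 < n by omega)
      exact one_div_le_one_div_of_le hn0 hn1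
    calc (L : ℝ) / (a + I * L) = ∑ n ∈ Ioc (a - L + I * L) (a - L + (I + 1) * L), (1 : ℝ) / (a + I * L) := by
          rw [Finset.sum_const, hcard, nsmul_eq_mul]; ring
      _ ≤ _ := Finset.sum_le_sum hle

/-- `∑_{i<I} L/(a + iL) ≤ 1 + log(a + IL)` for `1 ≤ L ≤ a`. -/
theorem sum_div_arith_prog_le {a L : ℕ} (hL : 1 ≤ L) (hLa : L ≤ a) (I : ℕ) :
    ∑ i ∈ range I, (L : ℝ) / (a + i * L) ≤ 1 + Real.log ((a : ℝ) + I * L) := by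
  refine (sum_div_arith_prog_le_harmonic hLa I).trans ?_
  have hN : 1 ≤ a - L + I * L ∨ I = 0 := by
    rcases Nat.eq_zero_or_pos I with h | h
    · exact Or.inr h
    · left; nlinarith
  rcases hN with hN | rfl
  · calc ∑ n ∈ Ioc (a - L) (a - L + I * L), (1 : ℝ) / n
        ≤ ∑ n ∈ Icc 1 (a - L + I * L), (1 : ℝ) / n := by
          refine Finset.sum_le_sum_of_subset_of_nonneg (fun n hn => ?_) fun n _ _ => by positivity
          rw [Finset.mem_Ioc] at hn; rw [Finset.mem_Icc]; omega
      _ ≤ 1 + Real.log ((a - L + I * L : ℕ) : ℝ) := by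
          have h := harmonic_le_one_add_log (a - L + I * L)
          rw [harmonic_eq_sum_Icc] at h; push_cast at h
          simpa [one_div] using h
      _ ≤ 1 + Real.log ((a : ℝ) + I * L) := by
          have h0 : (0 : ℝ) < ((a - L + I * L : ℕ) : ℝ) := by
            exact_mod_cast (show 0 < a - L + I * L by omega)
          have h1 : ((a - L + I * L : ℕ) : ℝ) ≤ (a : ℝ) + I * L := by
            have : a - L + I * L ≤ a + I * L := by omega
            exact_mod_cast this
          linarith [Real.log_le_log h0 h1]
  · simp only [zero_mul, add_zero, Finset.Ioc_self, Finset.sum_empty, Nat.cast_zero]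
    have : (1 : ℝ) ≤ a := by exact_mod_cast (hL.trans hLa)
    linarith [Real.log_nonneg this]

/-- **Height window.**  For `d ∈ (D', D'+L]`, `1 ≤ r ≤ R`: the switched height
`⌊(r⌊u/r⌋ + 2)/d⌋` lies in `[V₀, V₀ + H]` with `V₀ = ⌊(u+3−R)/(D'+L)⌋` and
`H = ⌊(u+2)/(D'+1)⌋ − V₀` (truncated). -/
theorem height_window {D' L R u d r : ℕ} (hd : d ∈ Ioc D' (D' + L)) (hr : r ∈ Icc 1 R) :
    (u + 3 - R) / (D' + L) ≤ (r * (u / r) + 2) / d ∧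
      (r * (u / r) + 2) / d ≤ (u + 3 - R) / (D' + L) + ((u + 2) / (D' + 1) - (u + 3 - R) / (D' + L)) := by
  rw [Finset.mem_Ioc] at hd
  rw [Finset.mem_Icc] at hr
  have h1 : u + 3 - R ≤ r * (u / r) + 2 := by
    have := Nat.div_add_mod u r
    have := Nat.mod_lt u (show 0 < r by omega)
    omega
  have h2 : r * (u / r) + 2 ≤ u + 2 := by have := Nat.mul_div_le u r; omega
  constructor
  · exact Nat.div_le_div h1 hd.2 (by omega)
  · have : (r * (u / r) + 2) / d ≤ (u + 2) / (D' + 1) := Nat.div_le_div h2 (by omega) (by omega)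
    omega

/-- The width of the height window: `H ≤ (x+2)L/(D'+1)² + R/(D'+1) + 1` for `u ≤ x`, `L ≥ 1`. -/
theorem height_window_H_le {D' L R u x : ℕ} (hL : 1 ≤ L) (hu : u ≤ x) :
    ((((u + 2) / (D' + 1) - (u + 3 - R) / (D' + L) : ℕ)) : ℝ) ≤
      ((x : ℝ) + 2) * L / ((D' : ℝ) + 1) ^ 2 + (R : ℝ) / ((D' : ℝ) + 1) + 1 := by
  have hD1 : (0 : ℝ) < (D' : ℝ) + 1 := by positivity
  have hDL : (0 : ℝ) < (D' : ℝ) + L := by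
    have : (1:ℝ) ≤ L := by exact_mod_cast hL
    positivity
  -- real bounds for the two floors
  have hB : (((u + 2) / (D' + 1) : ℕ) : ℝ) ≤ ((u : ℝ) + 2) / ((D' : ℝ) + 1) := by
    have := Nat.cast_div_le (α := ℝ) (m := u + 2) (n := D' + 1); push_cast at this; exact this
  have hV : ((u : ℝ) + 3 - R) / ((D' : ℝ) + L) - 1 ≤ (((u + 3 - R) / (D' + L) : ℕ) : ℝ) := by
    have h1 : ((u : ℝ) + 3 - R) ≤ ((u + 3 - R : ℕ) : ℝ) := by
      have h0 : ((u + 3 : ℕ) : ℝ) ≤ ((u + 3 - R : ℕ) : ℝ) + R := by exact_mod_cast le_tsub_add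
      push_cast at h0; linarith
    have h2 : ((u + 3 - R : ℕ) : ℝ) / ((D' : ℝ) + L) - 1 ≤ (((u + 3 - R) / (D' + L) : ℕ) : ℝ) := by
      have := Nat.lt_div_mul_add (a := u + 3 - R) (b := D' + L) (by omega)
      -- `a < (a / b) * b + b` gives `a / b - 1 < ⌊a/b⌋`
      have h3 : ((u + 3 - R : ℕ) : ℝ) < ((((u + 3 - R) / (D' + L) : ℕ)) : ℝ) * ((D' : ℝ) + L) +
          ((D' : ℝ) + L) := by exact_mod_cast this
      rw [sub_le_iff_le_add, div_le_iff₀ hDL]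
      linarith
    have h4 : ((u : ℝ) + 3 - R) / ((D' : ℝ) + L) ≤ ((u + 3 - R : ℕ) : ℝ) / ((D' : ℝ) + L) :=
      div_le_div_of_nonneg_right h1 hDL.le
    linarith
  -- the window width
  have hsub : ((((u + 2) / (D' + 1) - (u + 3 - R) / (D' + L) : ℕ)) : ℝ) ≤
      max (((u : ℝ) + 2) / ((D' : ℝ) + 1) - (((u : ℝ) + 3 - R) / ((D' : ℝ) + L) - 1)) 0 := by
    rcases le_total ((u + 2) / (D' + 1)) ((u + 3 - R) / (D' + L)) with h | h
    · rw [Nat.sub_eq_zero_of_le h]; simp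
    · rw [Nat.cast_sub h]
      exact le_trans (by linarith) (le_max_left _ _)
  refine hsub.trans (max_le ?_ (by positivity))
  -- `(u+2)/(D'+1) - (u+3-R)/(D'+L) + 1 ≤ (x+2) L/(D'+1)^2 + R/(D'+1) + 1`
  have hux : (u : ℝ) ≤ x := by exact_mod_cast hu
  have hL1 : (1 : ℝ) ≤ L := by exact_mod_cast hL
  have hkey : ((u : ℝ) + 2) / ((D' : ℝ) + 1) - ((u : ℝ) + 3 - R) / ((D' : ℝ) + L) ≤
      ((x : ℝ) + 2) * L / ((D' : ℝ) + 1) ^ 2 + (R : ℝ) / ((D' : ℝ) + 1) := by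
    rw [div_sub_div _ _ hD1.ne' hDL.ne', div_le_iff₀ (by positivity)]
    have hD0 : (0 : ℝ) ≤ D' := Nat.cast_nonneg _
    have hR0 : (0 : ℝ) ≤ R := Nat.cast_nonneg _
    have hu0 : (0 : ℝ) ≤ u := Nat.cast_nonneg _
    -- `(u+2)(D'+L) - (u+3-R)(D'+1) ≤ (u+2)(L-1) + R(D'+1) ≤ ...`
    have e1 : ((x : ℝ) + 2) * L / ((D' : ℝ) + 1) ^ 2 * (((D' : ℝ) + 1) * ((D' : ℝ) + L)) =
        ((x : ℝ) + 2) * L * (((D' : ℝ) + L) / ((D' : ℝ) + 1)) := by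
      field_simp
    have e2 : (R : ℝ) / ((D' : ℝ) + 1) * (((D' : ℝ) + 1) * ((D' : ℝ) + L)) = R * ((D' : ℝ) + L) := by
      field_simp
    have e3 : (((x : ℝ) + 2) * L / ((D' : ℝ) + 1) ^ 2 + (R : ℝ) / ((D' : ℝ) + 1)) *
        (((D' : ℝ) + 1) * ((D' : ℝ) + L)) =
        ((x : ℝ) + 2) * L * (((D' : ℝ) + L) / ((D' : ℝ) + 1)) + R * ((D' : ℝ) + L) := by
      rw [add_mul, e1, e2]
    rw [e3]
    have h5 : 1 ≤ ((D' : ℝ) + L) / ((D' : ℝ) + 1) := by rw [le_div_iff₀ hD1]; linarith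
    nlinarith [mul_nonneg (mul_nonneg (by positivity : (0:ℝ) ≤ (x : ℝ) + 2) (by positivity : (0:ℝ) ≤ (L:ℝ)))
      (sub_nonneg.mpr h5), mul_nonneg hR0 hD0, mul_nonneg hu0 hD0]
  linarith

/-- **Piece membership.**  If `D₁ < d` and `(d − D₁ − 1)/L = i` (`L ≥ 1`), then `d` lies in the
`i`-th piece `(D₁ + iL, D₁ + iL + L]`. -/
theorem mem_piece_Ioc {D₁ L d i : ℕ} (hL : 0 < L) (hd : D₁ < d) (hi : (d - D₁ - 1) / L = i) :
    d ∈ Ioc (D₁ + i * L) (D₁ + i * L + L) := by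
  have h3 : L * i + (d - D₁ - 1) % L = d - D₁ - 1 := by rw [← hi]; exact Nat.div_add_mod _ _
  have h4 := Nat.mod_lt (d - D₁ - 1) hL
  rw [Finset.mem_Ioc, mul_comm i L]
  generalize L * i = m at h3 ⊢
  omega

/-- **Piece index bound.**  If `d ≤ D` then `(d − D₁ − 1)/L < D/L + 1`. -/
theorem piece_index_lt {D D₁ L d : ℕ} (hd : d ≤ D) : (d - D₁ - 1) / L < D / L + 1 := by
  have : (d - D₁ - 1) / L ≤ D / L := Nat.div_le_div_right (by omega)
  omega

end Summit.Parity.GeneralizedHardyLittlewood.Theorems
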